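import Mathlib
import Summits.NavierStokesRegularity.NavierStokesRegularity.Theorems.HeteroclinicTriggerChainTriggerChainFrontStepForcedArcWithin
import Summits.NavierStokesRegularity.NavierStokesRegularity.Theorems.HeteroclinicTriggerChainTriggerChainFrontStepForcedArcExp
import Summits.NavierStokesRegularity.NavierStokesRegularity.Theorems.HeteroclinicTriggerChainTriggerChainFrontStepForcedArcRadius
import Summits.NavierStokesRegularity.NavierStokesRegularity.Theorems.HeteroclinicTriggerChainTriggerChainFrontStepForcedArcZero
import HarnessLib

/-!
# `HeteroclinicTriggerChain` — crux `TriggerChainFrontStep` (item stmt-NavierStokesRegularity-22785):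
  the POST-IGNITION TRANSFER of the forced arc, composed (crossing of equal split + exponential capture)

Composition of the landed forced-arc lemmas into the statement the lifespan pinch needs. Setting: on
`[0,T]` (derivatives within the segment) `D′ = −2e·u² + f₁`, `u′ = e·D·u + f₂`, `|f₁|, |f₂| ≤ φ`, an
ignited trigger (energy `u(0)²` above `m` plus the radius drift) and initial radius `≤ ρ₀`. Then
(`heteroclinicTriggerChain_forcedArcOn_transfer`):

1. the front-block envelope `M = ρ₀ + √3φT` holds throughout (`…ForcedArcRadius`, no circularity);
2. the carrier surplus reaches equal split, `D(t₀) ≤ 0`, by `t₀ ≤ D(0)/(2em − φ)` (`…ForcedArcWithin`,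
   capture with `L = 0`);
3. it never returns (`…ForcedArcZero`) and the transfer then completes EXPONENTIALLY
   (`…ForcedArcExp`): `D(t) + ρ₋ ≤ ρ₋·e^{−eρ₋(t−t₀)} + φ/(eρ₋)` on `[t₀,T]`, where `ρ₋² = ρ² − 6MφT` is
   the drifted radius (`ρ² = D(0)² + 2u(0)²`).

So the incompleteness `δ` is reached by `t₀ + log(ρ₋/δ′)/(eρ₋)` (`δ′ = δ − φ/(eρ₋)`): transfer time
`O(1/(eh²)) + O(log(1/δ)/e)` after ignition, uniformly over the ball — the input of the §1 pinch of
the crux note `Cruxes/TriggerChainFrontStep/DESIGN-NOTE-p5.md`.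

HONEST FRAMING: elementary real analysis of a planar ODE with bounded forcing on a segment; helper lemma
for the crux (no stub credit); nothing here is a statement about the Navier–Stokes equations; no summit,
rung or crux is proved by this file.
-/

noncomputable section

set_option linter.dupNamespace false

open Real Set

namespace Summit.NavierStokesRegularity.NavierStokesRegularity.Theorems

/-- **Post-ignition transfer of the forced arc.** See the module docstring. Hypotheses: `e > 0`,
`0 ≤ T`, the forced arc on `[0,T]` with `|f₁|, |f₂| ≤ φ`, initial radius `D(0)² + 2u(0)² ≤ ρ₀²`
(`ρ₀ ≥ 0`), `M = ρ₀ + √3φT`, an ignition level `m` with `φ < 2em` and `2m + 6MφT ≤ 2u(0)²`, the window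
`D(0)/(2em − φ) ≤ T`, and a drifted radius `0 < ρ₋`, `ρ₋² + 6MφT ≤ D(0)² + 2u(0)²`, `φ < eρ₋²`.
Conclusion: some `t₀ ∈ [0, max 0 (D(0)/(2em−φ))]` has `D(t₀) ≤ 0`, and for all `t ∈ [t₀, T]`:
`D(t) ≤ 0` and `D(t) + ρ₋ ≤ ρ₋·exp(−eρ₋(t−t₀)) + φ/(eρ₋)`. [this file] -/
theorem heteroclinicTriggerChain_forcedArcOn_transfer {e φ ρ₀ ρm M m T : ℝ} {D u f₁ f₂ : ℝ → ℝ}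
    (he : 0 < e) (hT : 0 ≤ T) (hρ₀ : 0 ≤ ρ₀)
    (hD : ∀ t ∈ Icc 0 T, HasDerivWithinAt D (-(2 * e * u t ^ 2) + f₁ t) (Icc 0 T) t)
    (hu : ∀ t ∈ Icc 0 T, HasDerivWithinAt u (e * D t * u t + f₂ t) (Icc 0 T) t)
    (hf₁ : ∀ t ∈ Icc 0 T, |f₁ t| ≤ φ) (hf₂ : ∀ t ∈ Icc 0 T, |f₂ t| ≤ φ)
    (hQ0 : D 0 ^ 2 + 2 * u 0 ^ 2 ≤ ρ₀ ^ 2) (hM : M = ρ₀ + Real.sqrt 3 * φ * T)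
    (hφm : φ < 2 * e * m) (hu0 : 2 * m + 6 * M * φ * T ≤ 2 * u 0 ^ 2)
    (hTT : D 0 / (2 * e * m - φ) ≤ T)
    (hρm : 0 < ρm) (hρmQ : ρm ^ 2 + 6 * M * φ * T ≤ D 0 ^ 2 + 2 * u 0 ^ 2) (hφρ : φ < e * ρm ^ 2) :
    ∃ t₀ ∈ Icc 0 (max 0 (D 0 / (2 * e * m - φ))), D t₀ ≤ 0 ∧
      ∀ t ∈ Icc t₀ T, D t ≤ 0 ∧ D t + ρm ≤ ρm * Real.exp (-(e * ρm * (t - t₀))) + φ / (e * ρm) := by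
  have hφ : 0 ≤ φ := (abs_nonneg _).trans (hf₁ 0 ⟨le_rfl, hT⟩)
  have h3 : 0 ≤ Real.sqrt 3 := Real.sqrt_nonneg _
  have hM0 : 0 ≤ M := by rw [hM]; positivity
  -- 1. the envelope from the radius
  have henv := heteroclinicTriggerChain_forcedArcOn_envelope hρ₀ hD hu hf₁ hf₂ hQ0
  have hDM : ∀ t ∈ Icc 0 T, |D t| ≤ M := by
    intro t ht
    have h := (henv t ht).1
    have : Real.sqrt 3 * φ * t ≤ Real.sqrt 3 * φ * T :=
      mul_le_mul_of_nonneg_left ht.2 (mul_nonneg h3 hφ)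
    rw [hM]; linarith
  have huM : ∀ t ∈ Icc 0 T, |u t| ≤ M := by
    intro t ht
    have h := (henv t ht).2
    have hle : ρ₀ + Real.sqrt 3 * φ * t ≤ M := by
      have : Real.sqrt 3 * φ * t ≤ Real.sqrt 3 * φ * T :=
        mul_le_mul_of_nonneg_left ht.2 (mul_nonneg h3 hφ)
      rw [hM]; linarith
    have hnn : 0 ≤ ρ₀ + Real.sqrt 3 * φ * t := by
      have : 0 ≤ Real.sqrt 3 * φ * t := mul_nonneg (mul_nonneg h3 hφ) ht.1
      linarith
    have hsq : u t ^ 2 ≤ M ^ 2 := by nlinarith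
    exact abs_le_of_sq_le_sq' hsq hM0 |> fun h' => abs_le.2 h'
  -- 2. equal split is reached (capture with L = 0)
  have hL : (0 : ℝ) ^ 2 + 2 * m + 6 * M * φ * T ≤ D 0 ^ 2 + 2 * u 0 ^ 2 := by
    nlinarith [sq_nonneg (D 0)]
  have hTT' : (D 0 + 0) / (2 * e * m - φ) ≤ T := by rw [add_zero]; exact hTT
  obtain ⟨t₀, ht₀, hDt₀⟩ :=
    heteroclinicTriggerChain_forcedArcOn_capture he hT hD hu hf₁ hf₂ hDM huM hφm hu0 hL hTT'
  rw [add_zero] at ht₀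
  have hDt₀' : D t₀ ≤ 0 := by simpa using hDt₀
  have ht₀T : t₀ ≤ T := ht₀.2.trans (max_le hT hTT)
  refine ⟨t₀, ht₀, hDt₀', ?_⟩
  -- the radius stays above ρ₋ on the whole window
  have hdrift := heteroclinicTriggerChain_forcedArcOn_radius_drift hD hu hf₁ hf₂ hDM huM
  have hQlow : ∀ t ∈ Icc 0 T, ρm ^ 2 ≤ D t ^ 2 + 2 * u t ^ 2 := by
    intro t ht
    have h := (abs_le.1 (hdrift t ht)).1
    have : 6 * M * φ * t ≤ 6 * M * φ * T :=
      mul_le_mul_of_nonneg_left ht.2 (by positivity)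
    linarith
  -- restrict to [t₀, T]
  have hD' : ∀ t ∈ Icc t₀ T, HasDerivWithinAt D (-(2 * e * u t ^ 2) + f₁ t) (Icc t₀ T) t :=
    fun t ht => (hD t ⟨ht₀.1.trans ht.1, ht.2⟩).mono (Icc_subset_Icc_left ht₀.1)
  have hf₁' : ∀ t ∈ Icc t₀ T, |f₁ t| ≤ φ := fun t ht => hf₁ t ⟨ht₀.1.trans ht.1, ht.2⟩
  have hQ' : ∀ t ∈ Icc t₀ T, ρm ^ 2 ≤ D t ^ 2 + 2 * u t ^ 2 := fun t ht =>
    hQlow t ⟨ht₀.1.trans ht.1, ht.2⟩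
  -- 3. no return, then exponential capture
  have hnonpos := heteroclinicTriggerChain_forcedArcOn_nonpos_after he hD' hf₁' hQ' hφρ hDt₀'
  have hexp := heteroclinicTriggerChain_forcedArcOn_exp_capture he hρm hD' hf₁' hnonpos hQ'
  intro t ht
  refine ⟨hnonpos t ht, ?_⟩
  have h := hexp t ht
  have hmax : max (D t₀ + ρm) 0 ≤ ρm := max_le (by linarith) hρm.le
  have hexp0 : 0 ≤ Real.exp (-(e * ρm * (t - t₀))) := (Real.exp_pos _).le
  nlinarith [mul_le_mul_of_nonneg_right hmax hexp0]

end Summit.NavierStokesRegularity.NavierStokesRegularity.Theorems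

end
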